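/-
Copyright (c) 2026 the pub-hodgecm-mathlib formalisation cell (harness21).  Prover seat hodgecm-mathlib-K2E4-p11 (g4), Track B ∕ K2-LIT, h413 =
`stmt-HodgeConjecture-24833`, line `K2_E1_TraceFormulaBeta`, campaign «EIS-RANK-ONE», rung R6d₃, deal «(R3u)₃» of K2E1-plan (g4) 2026-09-04T07:03:26Z, FILE U1:
★ PART II (p857895, this lineage) CONSTANTS-FIRST — the constants `C′` of the two fibrewise archimedean triples are bound BEFORE the section `f` and the envelope `𝓔`,
so that a FAMILY of sections `f_z`, `z ∈ Kc`, gets ONE constant (the input of the z-uniform cusp bound).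
-/
import Summits.HodgeConjecture.HodgeConjecture.Theorems.K2E1FlatSectionLineRestrictionArchU3   -- ★ p857895∕p857905 PART II (K2E4-p11 (g3)): the per-section triples, §0 tube lemma; brings ★ p857800, ★ FILE A∕B
import HarnessLib

/-!
# h413 ∕ Track B «K2-LIT», «EIS-RANK-ONE» (R3u)₃ FILE U1 — `K2E1FlatSectionLineRestrictionArchFamilyU3`: ★ PART II with the constants in front of the section

Cell `pub/hodgecm-mathlib`, crux H413 = `stmt-HodgeConjecture-24833`, route `HCCMUnconditional`; dealer K2E1-plan (g4), deal «(R3u)₃» 2026-09-04T07:03:26Z (the z-UNIFORM edition of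
the rank-3 cusp bound ★ p858097∕p858125 on a compact `Kc ⊂ {2 < Re z}`), REPORT-FIRST 07:05:55Z.  THEOREMS ONLY (no `def`, no `instance`, no `notation`, no named-fact hypothesis, no
`sorry`); lane `--kind proof --supports stmt-HodgeConjecture-24833 --as helper` (count-neutral).

WHY.  ★ PART II `exists_fibre_majorant_centre_of_archSmooth_three` ∕ `exists_fibre_majorant_centreAverage_of_archSmooth_three` are stated `theorem … (f) (𝓔) … : ∃ C′, …`: the constant
is bound AFTER the section, so a family `f_z` (`z ∈ Kc`) only receives opaque `C′(z)`.  Their PROOFS are uniform — `C′ = C·(m+1)·c₀⁻¹` with `C` from ★ p857740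
`exists_forall_norm_integral_mul_adeleAddChar_le` and `c₀` from ★ p857712 `exists_integral_adele_eq_smul_integral_prod`, both depending only on the measures and `m` — so this file
re-states them CONSTANTS-FIRST (`∃ C′ ≥ 0, ∀ {f 𝓔 N} (hypotheses), ∃ A, …`) with the proofs of ★ PART II verbatim after hoisting the `refine ⟨C′, …⟩`.
* **`exists_const_fibre_majorant_centre_of_archSmooth_three`** (F-layer, centre lines): `∃ C′ ≥ 0, ∀ f 𝓔, h𝓔U → ∀ N, h𝓔i → h𝓔N → hφarch → ∃ A, (∀ k X, Integrable ∧ ∫ A ≤ C′·N X) ∧ hdec`.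
* **`exists_const_fibre_majorant_centreAverage_of_archSmooth_three`** (E-layer, centre averages): `∃ C′ ≥ 0, ∀ f 𝓔, h𝓔U → h𝓔iE → ∀ N, h𝓔NE → hφarchZ → ∃ A, (∀ k, Integrable ∧
  ∫ A ≤ C′·max N 0) ∧ hdec` — the mass bound `N₂ = C′·max N 0` now EXPLICIT in the E-layer mass `N`.
HONEST LABEL.  Count-neutral helper; proves no printed statement; HC_CM is proved only modulo the 7 printed citations (2 remaining named inputs: hLiu418 =
`stmt-HodgeConjecture-24832`, h413 = `stmt-HodgeConjecture-24833`) until rung 0 closes.  `hφarch` ∕ `hφarchZ` and the envelope masses remain binders of the callers.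

## References
* [MoeglinWaldspurger1995] C. Mœglin, J.-L. Waldspurger, *Spectral decomposition and Eisenstein series* (1995), I.2.10–I.2.12, II.1.7, IV.2.
* [Garrett2018] P. Garrett, *Modern Analysis of Automorphic Forms by Example* 1 (2018), §2.9, §12.2.
* [CasselsFrohlichANT1967] J. Tate, *Fourier analysis in number fields and Hecke's zeta-functions*, in Cassels–Fröhlich (1967), Ch. XV §3.3, §4.2.
-/

set_option autoImplicit false
set_option linter.dupNamespace false  -- the mandated namespace repeats the summit's segment (`HodgeConjecture.HodgeConjecture`)

noncomputable section

open MeasureTheory Measure Filter Topology NumberField NumberField.mixedEmbedding IsDedekindDomain MulAction Module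
open Literature.NumberTheory.Automorphic Literature.NumberTheory.Automorphic.UnitaryGroup
open Summit.HodgeConjecture.HodgeConjecture.Cruxes.H413.K2E1FlatSectionLineRestrictionArchU2
open Summit.HodgeConjecture.HodgeConjecture.Cruxes.H413.K2E1InfiniteAdeleFourierDecay
open Summit.HodgeConjecture.HodgeConjecture.Cruxes.H413.K2E1AdelicFourierEnvelope
open Summit.HodgeConjecture.HodgeConjecture.Cruxes.H413.K2E1FlatSectionLineRestrictionU3
open Summit.HodgeConjecture.HodgeConjecture.Cruxes.H413.K2E1FlatSectionCentreAverageU3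
open Summit.HodgeConjecture.HodgeConjecture.Cruxes.H413.K2E1FlatSectionLineRestrictionArchU3
-- `Classical` is needed to see the Mathlib normed-space instances on `mixedSpace` (note H5 of `AdelicGLnGlue`)
open scoped ENNReal NNReal Classical Pointwise

namespace Summit.HodgeConjecture.HodgeConjecture.Cruxes.H413.K2E1FlatSectionLineRestrictionArchFamilyU3

variable {F E : Type} [Field F] [NumberField F] [Field E] [NumberField E] [Algebra F E] [Algebra.IsQuadraticExtension F E] {c : E ≃ₐ[F] E} {δ : E}
  [MeasurableSpace (AdeleRing (𝓞 F) F)] [BorelSpace (AdeleRing (𝓞 F) F)]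

/-! ## §1 (F) The centre layer, constants first -/

section Centre

variable [MeasurableSpace (InfiniteAdeleRing F)] [BorelSpace (InfiniteAdeleRing F)]
  [MeasurableSpace (FiniteAdeleRing (𝓞 F) F)] [BorelSpace (FiniteAdeleRing (𝓞 F) F)]

/-- **(F) THE FIBREWISE ARCHIMEDEAN TRIPLE OF THE CENTRE LAYER, CONSTANTS FIRST.**  For a compact `K`, an open finite level `U₀` and `m : ℕ` there is ONE `C′ ≥ 0` such that for EVERY
section `f`, envelope `𝓔` (right-invariant under `π⁻¹(U₀)`, integrable along every centre line with `∫ 𝓔 ≤ N(X)`) and `hφarch` (`C^m` along `ι_F` with `𝓔` on the derivatives):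
majorants `A k X` with `∫ A k X dμ₂ ≤ C′·N(X)` and `‖∫ Φ_k(X,(a,b))·ψ_F(y a) dμ₁(a)‖ ≤ A k X b·(1 + ‖ι_F y‖)^{−m}` — ★ PART II `exists_fibre_majorant_centre_of_archSmooth_three` with `C′ = C·(m+1)·c₀⁻¹`
bound before `f`. [cite: MoeglinWaldspurger1995, I.2.10–I.2.12] [cite: Garrett2018, §2.9, §12.2] -/
theorem exists_const_fibre_majorant_centre_of_archSmooth_three (hc : c * c = 1) (hcδ : c δ = -δ) (hδ : δ ≠ 0)
    (μ : Measure (AdeleRing (𝓞 F) F)) [μ.IsAddHaarMeasure]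
    (μ₁ : Measure (InfiniteAdeleRing F)) [μ₁.IsAddHaarMeasure] (μ₂ : Measure (FiniteAdeleRing (𝓞 F) F)) [μ₂.IsAddHaarMeasure]
    {K : Set (quasiSplit F E c 3).Adelic} (hK : IsCompact K)
    {U₀ : Subgroup (GL (Fin 3) (FiniteAdeleRing (𝓞 E) E))} (hU₀o : IsOpen (U₀ : Set (GL (Fin 3) (FiniteAdeleRing (𝓞 E) E)))) (m : ℕ) :
    ∃ C' : ℝ, 0 ≤ C' ∧ ∀ {f : (quasiSplit F E c 3).Adelic → ℂ} {𝓔 : (quasiSplit F E c 3).Adelic → ℝ},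
    (∀ u : (quasiSplit F E c 3).Adelic, adelicVal F E c 3 _ u ∈ U₀.map (GLn.ofFinite 3 E) → ∀ y : (quasiSplit F E c 3).Adelic, 𝓔 (y * u) = 𝓔 y) →
    ∀ {N : AdeleRing (𝓞 E) E → ℝ},
    (∀ k ∈ K, ∀ X : AdeleRing (𝓞 E) E, Integrable (fun t : AdeleRing (𝓞 F) F =>
      𝓔 (((quasiSplit F E c 3).toAdelic (weylLongU (c : E →+* E) (rfl : ((StdForm.antidiagonal 3).over E) = ((StdForm.antidiagonal 3).over E)))) *
        ((heisChart hc (X, traceZeroLine F E c hcδ hδ t) : ↥(adelicUnipotent F E c 3)) : (quasiSplit F E c 3).Adelic) * k)) μ) →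
    (∀ k ∈ K, ∀ X : AdeleRing (𝓞 E) E, ∫ t, 𝓔 (((quasiSplit F E c 3).toAdelic (weylLongU (c : E →+* E) (rfl : ((StdForm.antidiagonal 3).over E) = ((StdForm.antidiagonal 3).over E)))) *
        ((heisChart hc (X, traceZeroLine F E c hcδ hδ t) : ↥(adelicUnipotent F E c 3)) : (quasiSplit F E c 3).Adelic) * k) ∂μ ≤ N X) →
    (∀ k ∈ K, ∀ (X : AdeleRing (𝓞 E) E) (b : FiniteAdeleRing (𝓞 F) F),
      ContDiff ℝ m ((fun a : InfiniteAdeleRing F => f (((quasiSplit F E c 3).toAdelic (weylLongU (c : E →+* E) (rfl : ((StdForm.antidiagonal 3).over E) = ((StdForm.antidiagonal 3).over E)))) *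
          ((heisChart hc (X, traceZeroLine F E c hcδ hδ ((a, b) : AdeleRing (𝓞 F) F)) : ↥(adelicUnipotent F E c 3)) : (quasiSplit F E c 3).Adelic) * k)) ∘
        (InfiniteAdeleRing.ringEquiv_mixedSpace F).symm) ∧
      ∀ j : ℕ, j ≤ m → ∀ s : mixedSpace F,
        ‖iteratedFDeriv ℝ j ((fun a : InfiniteAdeleRing F => f (((quasiSplit F E c 3).toAdelic (weylLongU (c : E →+* E) (rfl : ((StdForm.antidiagonal 3).over E) = ((StdForm.antidiagonal 3).over E)))) *
          ((heisChart hc (X, traceZeroLine F E c hcδ hδ ((a, b) : AdeleRing (𝓞 F) F)) : ↥(adelicUnipotent F E c 3)) : (quasiSplit F E c 3).Adelic) * k)) ∘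
          (InfiniteAdeleRing.ringEquiv_mixedSpace F).symm) s‖ ≤
          𝓔 (((quasiSplit F E c 3).toAdelic (weylLongU (c : E →+* E) (rfl : ((StdForm.antidiagonal 3).over E) = ((StdForm.antidiagonal 3).over E)))) *
          ((heisChart hc (X, traceZeroLine F E c hcδ hδ ((((InfiniteAdeleRing.ringEquiv_mixedSpace F).symm s), b) : AdeleRing (𝓞 F) F)) : ↥(adelicUnipotent F E c 3)) :
            (quasiSplit F E c 3).Adelic) * k)) →
    ∃ A : (quasiSplit F E c 3).Adelic → AdeleRing (𝓞 E) E → FiniteAdeleRing (𝓞 F) F → ℝ,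
      (∀ k ∈ K, ∀ X : AdeleRing (𝓞 E) E, Integrable (A k X) μ₂ ∧ ∫ b, A k X b ∂μ₂ ≤ C' * N X) ∧
      ∀ k ∈ K, ∀ (X : AdeleRing (𝓞 E) E) (b : FiniteAdeleRing (𝓞 F) F) (y : InfiniteAdeleRing F),
        ‖∫ a, f (((quasiSplit F E c 3).toAdelic (weylLongU (c : E →+* E) (rfl : ((StdForm.antidiagonal 3).over E) = ((StdForm.antidiagonal 3).over E)))) *
          ((heisChart hc (X, traceZeroLine F E c hcδ hδ ((a, b) : AdeleRing (𝓞 F) F)) : ↥(adelicUnipotent F E c 3)) : (quasiSplit F E c 3).Adelic) * k) *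
          (adeleAddChar F (infiniteAdeleInl F (y * a)) : ℂ) ∂μ₁‖ ≤ A k X b * (1 + ‖InfiniteAdeleRing.ringEquiv_mixedSpace F y‖) ^ (-(m : ℝ)) := by
  haveI := secondCountableTopology_infiniteAdeleRing F
  haveI := secondCountableTopology_finiteAdeleRing F
  haveI := locallyCompactSpace_finiteAdeleRing' F
  set W : (quasiSplit F E c 3).Adelic :=
    (quasiSplit F E c 3).toAdelic (weylLongU (c : E →+* E) (rfl : ((StdForm.antidiagonal 3).over E) = ((StdForm.antidiagonal 3).over E))) with hW
  -- the constants of ★ p857740 and ★ p857712 (F1)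
  obtain ⟨C, hC0, hC⟩ := exists_forall_norm_integral_mul_adeleAddChar_le F μ₁ m
  obtain ⟨c₀, hc₀, hc₀eq⟩ := exists_integral_adele_eq_smul_integral_prod F μ μ₁ μ₂
  have hc₀' : (c₀ : ℝ) ≠ 0 := (NNReal.coe_pos.2 hc₀).ne'
  refine ⟨C * (((m : ℝ) + 1) * (c₀ : ℝ)⁻¹), mul_nonneg hC0 (mul_nonneg (by positivity) (inv_nonneg.2 (NNReal.coe_nonneg c₀))), ?_⟩
  intro f 𝓔 h𝓔U N h𝓔i h𝓔N hφarch
  -- ONE level `𝔫` making the envelope fibres periodic for all `k ∈ K`, all `X` (★ FILE A tube lemma)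
  set U : Subgroup (quasiSplit F E c 3).Adelic := (U₀.map (GLn.ofFinite 3 E)).comap (adelicVal F E c 3 ((StdForm.antidiagonal 3).over E)) with hUdef
  have h𝓔U' : ∀ v ∈ U, ∀ y : (quasiSplit F E c 3).Adelic, 𝓔 (y * v) = 𝓔 y := fun v hv y => h𝓔U v (Subgroup.mem_comap.1 hv) y
  obtain ⟨𝔫, -, 𝔪, -, htube⟩ := exists_levelIdeal_forall_adelicVal_conj_heisChart_mem_three hc hcδ hδ hK hU₀o
  have hE0 : ((((0 : InfiniteAdeleRing E), (0 : FiniteAdeleRing (𝓞 E) E)) : AdeleRing (𝓞 E) E)) = 0 := rfl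
  have hper : ∀ k ∈ K, ∀ (X : AdeleRing (𝓞 E) E) (a : InfiniteAdeleRing F) (b : FiniteAdeleRing (𝓞 F) F), ∀ l ∈ levelIdeal F 𝔫,
      𝓔 (W * ((heisChart hc (X, traceZeroLine F E c hcδ hδ ((a, b + l) : AdeleRing (𝓞 F) F)) : ↥(adelicUnipotent F E c 3)) : (quasiSplit F E c 3).Adelic) * k) =
        𝓔 (W * ((heisChart hc (X, traceZeroLine F E c hcδ hδ ((a, b) : AdeleRing (𝓞 F) F)) : ↥(adelicUnipotent F E c 3)) : (quasiSplit F E c 3).Adelic) * k) := by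
    intro k hk X a b l hl
    have hk : k⁻¹ * ((heisChart hc ((0 : AdeleRing (𝓞 E) E), traceZeroLine F E c hcδ hδ (((0 : InfiniteAdeleRing F), l) : AdeleRing (𝓞 F) F)) :
        ↥(adelicUnipotent F E c 3)) : (quasiSplit F E c 3).Adelic) * k ∈ U := by
      have h' := htube k hk l hl 0 (levelIdeal E 𝔪).zero_mem
      rw [hE0] at h'
      exact Subgroup.mem_comap.2 h'
    have hpair : (((a, b + l)) : AdeleRing (𝓞 F) F) = ((a, b) : AdeleRing (𝓞 F) F) + (((0 : InfiniteAdeleRing F), l) : AdeleRing (𝓞 F) F) :=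
      Prod.ext (add_zero a).symm rfl
    rw [hpair]
    exact apply_weylLongU_mul_heisChart_add_eq hc hcδ hδ h𝓔U' hk X _
  -- the envelope along the centre lines, fibred: `e k X (a, b)`
  set e : (quasiSplit F E c 3).Adelic → AdeleRing (𝓞 E) E → InfiniteAdeleRing F × FiniteAdeleRing (𝓞 F) F → ℝ := fun k X p =>
    𝓔 (W * ((heisChart hc (X, traceZeroLine F E c hcδ hδ ((p.1, p.2) : AdeleRing (𝓞 F) F)) : ↥(adelicUnipotent F E c 3)) : (quasiSplit F E c 3).Adelic) * k) with he
  have hei : ∀ k ∈ K, ∀ X, Integrable (e k X) (μ₁.prod μ₂) := fun k hk X => by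
    have h := (integrable_iff_integrable_prod F μ μ₁ μ₂ (fun t : AdeleRing (𝓞 F) F =>
      ((𝓔 (W * ((heisChart hc (X, traceZeroLine F E c hcδ hδ t) : ↥(adelicUnipotent F E c 3)) : (quasiSplit F E c 3).Adelic) * k) : ℝ) : ℂ))).1 ((h𝓔i k hk X).ofReal)
    exact (h.re).congr (Eventually.of_forall fun p => by simp only [he, RCLike.re_to_complex, Complex.ofReal_re])
  have hfib : ∀ k ∈ K, ∀ X (b : FiniteAdeleRing (𝓞 F) F), Integrable (fun a => e k X (a, b)) μ₁ := fun k hk X b =>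
    integrable_fibre_of_periodic F μ₁ μ₂ (hei k hk X) 𝔫 (fun a b' l hl => by simp only [he]; exact hper k hk X a b' l hl) b
  refine ⟨fun k X b => C * (((m : ℝ) + 1) * ∫ a, e k X (a, b) ∂μ₁), fun k hk X => ⟨?_, ?_⟩, fun k hk X b y => ?_⟩
  · exact ((hei k hk X).integral_prod_right.const_mul ((m : ℝ) + 1)).const_mul C
  · rw [integral_const_mul, integral_const_mul, mul_assoc C, mul_assoc ((m : ℝ) + 1)]
    refine mul_le_mul_of_nonneg_left (mul_le_mul_of_nonneg_left ?_ (by positivity)) hC0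
    rw [← integral_prod_symm (e k X) (hei k hk X)]
    have hreal := integral_real_adele_eq_mul_integral_prod F hc₀eq (fun t : AdeleRing (𝓞 F) F =>
      𝓔 (W * ((heisChart hc (X, traceZeroLine F E c hcδ hδ t) : ↥(adelicUnipotent F E c 3)) : (quasiSplit F E c 3).Adelic) * k))
    have heq : ∫ p, e k X p ∂(μ₁.prod μ₂) = (c₀ : ℝ)⁻¹ * ∫ t, 𝓔 (W * ((heisChart hc (X, traceZeroLine F E c hcδ hδ t) : ↥(adelicUnipotent F E c 3)) :
        (quasiSplit F E c 3).Adelic) * k) ∂μ := by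
      rw [hreal, ← mul_assoc, inv_mul_cancel₀ hc₀', one_mul]
    rw [heq]
    exact mul_le_mul_of_nonneg_left (h𝓔N k hk X) (inv_nonneg.2 (NNReal.coe_nonneg c₀))
  · obtain ⟨hcd, henv⟩ := hφarch k hk X b
    exact norm_integral_fibre_le_of_contDiff F μ₁ hC0 hC hcd (hfib k hk X b) (fun j hj s => henv j hj s) y

end Centre

/-! ## §2 (E) The `E`-layer, constants first -/

section ELayer

variable [MeasurableSpace (AdeleRing (𝓞 E) E)] [BorelSpace (AdeleRing (𝓞 E) E)]
  [MeasurableSpace (InfiniteAdeleRing E)] [BorelSpace (InfiniteAdeleRing E)]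
  [MeasurableSpace (FiniteAdeleRing (𝓞 E) E)] [BorelSpace (FiniteAdeleRing (𝓞 E) E)]

/-- **(E) THE FIBREWISE ARCHIMEDEAN TRIPLE OF THE `E`-LAYER, CONSTANTS FIRST**: ONE `C′ ≥ 0` (`= C·(m+1)·c₀⁻¹` over `E`) such that for EVERY `f`, `𝓔` (level-invariant, averaged
envelope integrable on `𝔸_E` with `∫∫ 𝓔 ≤ N`) and `hφarchZ`: the triple (`A`, `N₂ := C′·max N 0`, `hdec`) of ★ p857712 over `E` for `Φ^Z_k` — ★ PART II
`exists_fibre_majorant_centreAverage_of_archSmooth_three` with the mass bound explicit in `N`. [cite: MoeglinWaldspurger1995, I.2.10–I.2.12, II.1.7] [cite: Garrett2018, §2.9, §12.2] -/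
theorem exists_const_fibre_majorant_centreAverage_of_archSmooth_three (hc : c * c = 1) (hcδ : c δ = -δ) (hδ : δ ≠ 0)
    (μF : Measure (AdeleRing (𝓞 F) F)) [μF.IsAddHaarMeasure]
    (μE : Measure (AdeleRing (𝓞 E) E)) [μE.IsAddHaarMeasure]
    (μ₁ : Measure (InfiniteAdeleRing E)) [μ₁.IsAddHaarMeasure] (μ₂ : Measure (FiniteAdeleRing (𝓞 E) E)) [μ₂.IsAddHaarMeasure]
    {K : Set (quasiSplit F E c 3).Adelic} (hK : IsCompact K)
    {U₀ : Subgroup (GL (Fin 3) (FiniteAdeleRing (𝓞 E) E))} (hU₀o : IsOpen (U₀ : Set (GL (Fin 3) (FiniteAdeleRing (𝓞 E) E)))) (m : ℕ) :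
    ∃ C' : ℝ, 0 ≤ C' ∧ ∀ {f : (quasiSplit F E c 3).Adelic → ℂ} {𝓔 : (quasiSplit F E c 3).Adelic → ℝ},
    (∀ u : (quasiSplit F E c 3).Adelic, adelicVal F E c 3 _ u ∈ U₀.map (GLn.ofFinite 3 E) → ∀ y : (quasiSplit F E c 3).Adelic, 𝓔 (y * u) = 𝓔 y) →
    (∀ k ∈ K, Integrable (fun X : AdeleRing (𝓞 E) E => ∫ t, 𝓔 (((quasiSplit F E c 3).toAdelic (weylLongU (c : E →+* E) (rfl : ((StdForm.antidiagonal 3).over E) = ((StdForm.antidiagonal 3).over E)))) *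
        ((heisChart hc (X, traceZeroLine F E c hcδ hδ t) : ↥(adelicUnipotent F E c 3)) : (quasiSplit F E c 3).Adelic) * k) ∂μF) μE) →
    ∀ {N : ℝ},
    (∀ k ∈ K, ∫ X, ∫ t, 𝓔 (((quasiSplit F E c 3).toAdelic (weylLongU (c : E →+* E) (rfl : ((StdForm.antidiagonal 3).over E) = ((StdForm.antidiagonal 3).over E)))) *
        ((heisChart hc (X, traceZeroLine F E c hcδ hδ t) : ↥(adelicUnipotent F E c 3)) : (quasiSplit F E c 3).Adelic) * k) ∂μF ∂μE ≤ N) →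
    (∀ k ∈ K, ∀ B : FiniteAdeleRing (𝓞 E) E,
      ContDiff ℝ m ((fun a : InfiniteAdeleRing E => ((μF (adeleFundamentalDomain F)).toReal⁻¹ : ℂ) *
          ∫ t, f (((quasiSplit F E c 3).toAdelic (weylLongU (c : E →+* E) (rfl : ((StdForm.antidiagonal 3).over E) = ((StdForm.antidiagonal 3).over E)))) *
            ((heisChart hc (((a, B) : AdeleRing (𝓞 E) E), traceZeroLine F E c hcδ hδ t) : ↥(adelicUnipotent F E c 3)) : (quasiSplit F E c 3).Adelic) * k) ∂μF) ∘
        (InfiniteAdeleRing.ringEquiv_mixedSpace E).symm) ∧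
      ∀ j : ℕ, j ≤ m → ∀ s : mixedSpace E,
        ‖iteratedFDeriv ℝ j ((fun a : InfiniteAdeleRing E => ((μF (adeleFundamentalDomain F)).toReal⁻¹ : ℂ) *
          ∫ t, f (((quasiSplit F E c 3).toAdelic (weylLongU (c : E →+* E) (rfl : ((StdForm.antidiagonal 3).over E) = ((StdForm.antidiagonal 3).over E)))) *
            ((heisChart hc (((a, B) : AdeleRing (𝓞 E) E), traceZeroLine F E c hcδ hδ t) : ↥(adelicUnipotent F E c 3)) : (quasiSplit F E c 3).Adelic) * k) ∂μF) ∘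
          (InfiniteAdeleRing.ringEquiv_mixedSpace E).symm) s‖ ≤
          ∫ t, 𝓔 (((quasiSplit F E c 3).toAdelic (weylLongU (c : E →+* E) (rfl : ((StdForm.antidiagonal 3).over E) = ((StdForm.antidiagonal 3).over E)))) *
            ((heisChart hc (((((InfiniteAdeleRing.ringEquiv_mixedSpace E).symm s), B) : AdeleRing (𝓞 E) E), traceZeroLine F E c hcδ hδ t) : ↥(adelicUnipotent F E c 3)) :
              (quasiSplit F E c 3).Adelic) * k) ∂μF) →
    ∃ A : (quasiSplit F E c 3).Adelic → FiniteAdeleRing (𝓞 E) E → ℝ,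
      (∀ k ∈ K, Integrable (A k) μ₂ ∧ ∫ B, A k B ∂μ₂ ≤ C' * max N 0) ∧
      ∀ k ∈ K, ∀ (B : FiniteAdeleRing (𝓞 E) E) (Y : InfiniteAdeleRing E),
        ‖∫ a, (((μF (adeleFundamentalDomain F)).toReal⁻¹ : ℂ) *
            ∫ t, f (((quasiSplit F E c 3).toAdelic (weylLongU (c : E →+* E) (rfl : ((StdForm.antidiagonal 3).over E) = ((StdForm.antidiagonal 3).over E)))) *
              ((heisChart hc (((a, B) : AdeleRing (𝓞 E) E), traceZeroLine F E c hcδ hδ t) : ↥(adelicUnipotent F E c 3)) : (quasiSplit F E c 3).Adelic) * k) ∂μF) *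
          (adeleAddChar E (infiniteAdeleInl E (Y * a)) : ℂ) ∂μ₁‖ ≤ A k B * (1 + ‖InfiniteAdeleRing.ringEquiv_mixedSpace E Y‖) ^ (-(m : ℝ)) := by
  haveI := secondCountableTopology_infiniteAdeleRing E
  haveI := secondCountableTopology_finiteAdeleRing E
  haveI := locallyCompactSpace_finiteAdeleRing' E
  set W : (quasiSplit F E c 3).Adelic :=
    (quasiSplit F E c 3).toAdelic (weylLongU (c : E →+* E) (rfl : ((StdForm.antidiagonal 3).over E) = ((StdForm.antidiagonal 3).over E))) with hW
  -- the constants of ★ p857740 and ★ p857712 (F1), over `E`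
  obtain ⟨C, hC0, hC⟩ := exists_forall_norm_integral_mul_adeleAddChar_le E μ₁ m
  obtain ⟨c₀, hc₀, hc₀eq⟩ := exists_integral_adele_eq_smul_integral_prod E μE μ₁ μ₂
  have hc₀' : (c₀ : ℝ) ≠ 0 := (NNReal.coe_pos.2 hc₀).ne'
  refine ⟨C * (((m : ℝ) + 1) * (c₀ : ℝ)⁻¹), mul_nonneg hC0 (mul_nonneg (by positivity) (inv_nonneg.2 (NNReal.coe_nonneg c₀))), ?_⟩
  intro f 𝓔 h𝓔U h𝓔i N h𝓔N hφarchZ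
  -- ONE level `𝔪` of `E` making the averaged envelope periodic in `B` for all `k ∈ K` (★ FILE A tube lemma + ★ FILE B periodicity)
  set U : Subgroup (quasiSplit F E c 3).Adelic := (U₀.map (GLn.ofFinite 3 E)).comap (adelicVal F E c 3 ((StdForm.antidiagonal 3).over E)) with hUdef
  have h𝓔U' : ∀ v ∈ U, ∀ y : (quasiSplit F E c 3).Adelic, 𝓔 (y * v) = 𝓔 y := fun v hv y => h𝓔U v (Subgroup.mem_comap.1 hv) y
  obtain ⟨𝔫, -, 𝔪, -, htube⟩ := exists_levelIdeal_forall_adelicVal_conj_heisChart_mem_three hc hcδ hδ hK hU₀o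
  have hθ0 : traceZeroLine F E c hcδ hδ ((((0 : InfiniteAdeleRing F), (0 : FiniteAdeleRing (𝓞 F) F)) : AdeleRing (𝓞 F) F)) = 0 := map_zero _
  have hper : ∀ k ∈ K, ∀ (a : InfiniteAdeleRing E) (B : FiniteAdeleRing (𝓞 E) E), ∀ L ∈ levelIdeal E 𝔪,
      ∫ t, 𝓔 (W * ((heisChart hc (((a, B + L) : AdeleRing (𝓞 E) E), traceZeroLine F E c hcδ hδ t) : ↥(adelicUnipotent F E c 3)) : (quasiSplit F E c 3).Adelic) * k) ∂μF =
        ∫ t, 𝓔 (W * ((heisChart hc (((a, B) : AdeleRing (𝓞 E) E), traceZeroLine F E c hcδ hδ t) : ↥(adelicUnipotent F E c 3)) : (quasiSplit F E c 3).Adelic) * k) ∂μF := by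
    intro k hk a B L hL
    have hk : k⁻¹ * ((heisChart hc ((((0 : InfiniteAdeleRing E), L) : AdeleRing (𝓞 E) E), (0 : traceZeroAdele F E c)) :
        ↥(adelicUnipotent F E c 3)) : (quasiSplit F E c 3).Adelic) * k ∈ U := by
      have h' := htube k hk 0 (levelIdeal F 𝔫).zero_mem L hL
      rw [hθ0] at h'
      exact Subgroup.mem_comap.2 h'
    have hpair : (((a, B + L)) : AdeleRing (𝓞 E) E) = ((a, B) : AdeleRing (𝓞 E) E) + (((0 : InfiniteAdeleRing E), L) : AdeleRing (𝓞 E) E) :=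
      Prod.ext (add_zero a).symm rfl
    rw [hpair]
    exact integral_weylLongU_mul_heisChart_add_eq hc hcδ hδ μF h𝓔U' hk _
  -- the averaged envelope, fibred: `e k (a, B)`
  set e : (quasiSplit F E c 3).Adelic → InfiniteAdeleRing E × FiniteAdeleRing (𝓞 E) E → ℝ := fun k p =>
    ∫ t, 𝓔 (W * ((heisChart hc (((p.1, p.2) : AdeleRing (𝓞 E) E), traceZeroLine F E c hcδ hδ t) : ↥(adelicUnipotent F E c 3)) : (quasiSplit F E c 3).Adelic) * k) ∂μF with he
  have hei : ∀ k ∈ K, Integrable (e k) (μ₁.prod μ₂) := fun k hk => by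
    have h := (integrable_iff_integrable_prod E μE μ₁ μ₂ (fun X : AdeleRing (𝓞 E) E =>
      ((∫ t, 𝓔 (W * ((heisChart hc (X, traceZeroLine F E c hcδ hδ t) : ↥(adelicUnipotent F E c 3)) : (quasiSplit F E c 3).Adelic) * k) ∂μF : ℝ) : ℂ))).1 ((h𝓔i k hk).ofReal)
    exact (h.re).congr (Eventually.of_forall fun p => by simp only [he, RCLike.re_to_complex, Complex.ofReal_re])
  have hfib : ∀ k ∈ K, ∀ B : FiniteAdeleRing (𝓞 E) E, Integrable (fun a => e k (a, B)) μ₁ := fun k hk B =>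
    integrable_fibre_of_periodic E μ₁ μ₂ (hei k hk) 𝔪 (fun a B' L hL => by simp only [he]; exact hper k hk a B' L hL) B
  refine ⟨fun k B => C * (((m : ℝ) + 1) * ∫ a, e k (a, B) ∂μ₁), fun k hk => ⟨?_, ?_⟩, fun k hk B Y => ?_⟩
  · exact ((hei k hk).integral_prod_right.const_mul ((m : ℝ) + 1)).const_mul C
  · rw [integral_const_mul, integral_const_mul, mul_assoc, mul_assoc]
    refine mul_le_mul_of_nonneg_left (mul_le_mul_of_nonneg_left ?_ (by positivity)) hC0
    rw [← integral_prod_symm (e k) (hei k hk)]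
    have hreal := integral_real_adele_eq_mul_integral_prod E hc₀eq (fun X : AdeleRing (𝓞 E) E =>
      ∫ t, 𝓔 (W * ((heisChart hc (X, traceZeroLine F E c hcδ hδ t) : ↥(adelicUnipotent F E c 3)) : (quasiSplit F E c 3).Adelic) * k) ∂μF)
    have heq : ∫ p, e k p ∂(μ₁.prod μ₂) = (c₀ : ℝ)⁻¹ * ∫ X, ∫ t, 𝓔 (W * ((heisChart hc (X, traceZeroLine F E c hcδ hδ t) : ↥(adelicUnipotent F E c 3)) :
        (quasiSplit F E c 3).Adelic) * k) ∂μF ∂μE := by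
      rw [hreal, ← mul_assoc, inv_mul_cancel₀ hc₀', one_mul]
    rw [heq]
    exact mul_le_mul_of_nonneg_left ((h𝓔N k hk).trans (le_max_left _ _)) (inv_nonneg.2 (NNReal.coe_nonneg c₀))
  · obtain ⟨hcd, henv⟩ := hφarchZ k hk B
    exact norm_integral_fibre_le_of_contDiff E μ₁ hC0 hC hcd (hfib k hk B) (fun j hj s => henv j hj s) Y

end ELayer

end Summit.HodgeConjecture.HodgeConjecture.Cruxes.H413.K2E1FlatSectionLineRestrictionArchFamilyU3

end
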